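import Mathlib
import HarnessLib
import Literature.MathematicalPhysics.QuantumLattice.GaugeGroups
import Literature.MathematicalPhysics.QuantumFieldTheory.ConstructiveQFTWave0
import Literature.MathematicalPhysics.QuantumFieldTheory.LatticeGaugeProofs
import Literature.MathematicalPhysics.QuantumFieldTheory.U1GinibreComparison
import Literature.MathematicalPhysics.QuantumFieldTheory.U1WardIdentity
import Literature.MathematicalPhysics.QuantumLattice.AbelianFieldTensor
import Literature.MathematicalPhysics.QuantumLattice.AbelianMagneticFlux
import Summits.Ventures.LatticeQCDFlow.Exactness.SymmetricMetropolis
import Summits.Ventures.LatticeQCDFlow.Scaling.FluxSectorCollar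
import Summits.Ventures.LatticeQCDFlow.Scaling.SliceTwistWitness
import Summits.Ventures.LatticeQCDFlow.Scaling.RowFields

/-!
# The two-sided flux-insertion Metropolis move: exactness and an acceptance floor

HONEST FRAMING: exact (Metropolis-corrected) sampling algorithms for lattice gauge theory;
figures of merit are autocorrelation/cost numbers at stated couplings and volumes; no
continuum-physics claim.

Venture `LatticeQCDFlow` (cell pub-lqcd), topic `Scaling`, FANOUT row 29 (theory2, gen-19), item 98.
NEW WORK of the cell over Mathlib and the cell's own `Exactness/SymmetricMetropolis` (row 9); nothing
here is cited as a fact.  Printed counterpart, named only: the "winding" / instanton-insertion moves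
of [AlbandeaEtAl2021, §3] (multiply the field by a fixed charge-one configuration, accept with the
Metropolis filter).

Items 91–97 bound the flux-tunnelling probability of an exact sampler from ABOVE.  This file gives
the matching CONSTRUCTION and a bound from BELOW.  For a fixed configuration `W` of a measurable
group `G` (the inserted flux) and a weight `p > 0`:

* §1 `insertionLaw W = ½(δ_W + δ_{W⁻¹})` (inversion-symmetric), `insertionMH W p` = the
  Metropolis kernel proposing `U ↦ W U` or `U ↦ W⁻¹ U` with probability `½` each and accepting with
  `min {1, p(proposal)/p(U)}`; it is a Markov kernel, EXACT (`p · Haar` is invariant,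
  `insertionMH_invariant`, from row 9's `mulWalkMH_invariant`), its set-wise formula
  `insertionMH_apply`, the floor `insertionMH_ge`, and its support `{U, WU, W⁻¹U}`
  (`insertionMH_eq_zero`).
* §2 ABELIAN ACTION IDENTITY (`U(1)`, every `d`, every `W`, every `U`):
  `S(WU) + S(W⁻¹U) = 2 S(U) + Σ_p 2(1 − Re W_p)(Re U_p − 1) + 2 S(W) − …` packaged as the inequality
  `S(WU) + S(W⁻¹U) ≤ 2 S(U) + 2 S(W)` (`wilsonAction_mul_add_inv_mul_le`): ONE of the two insertions
  costs at most the action `S(W)` of the inserted field, whatever `U` is.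
* §3 Hence under the Wilson weight `p = e^{−βS}`, `β ≥ 0`: at every `U` at which BOTH insertions change
  the flux charge, `insertionMH W p U {Q ≠ Q(U)} ≥ ½ e^{−β S(W)}` (`insertionMH_topCharge_ne_ge`), and
  for EVERY measure `μ` (no invariance needed for the floor)
  `(μ ⊗ insertionMH W p){Q ≠ Q'} ≥ ½ e^{−β S(W)} · μ{U | Q(WU) ≠ Q(U) ∧ Q(W⁻¹U) ≠ Q(U)}`
  (`compProd_insertionMH_topCharge_ne_ge`).

* §5 `wilsonAction_sliceTwist`: lean-1's wrapping-line twist has `S(sliceTwist L) = L(1 − cos(2π/L))`.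

The instance `W = sliceTwist L` with the Wilson-measure estimate of the good event is
`Scaling/FluxInsertionLine.lean` (item 99).
-/

noncomputable section

-- LANDING NOTE (lean-1 GEN-5): the local copy of the plaquette-inversion lemma was deleted (gate
-- `dedup.landed`); the tree's `plaquetteHolonomy_inv` from `Literature/…/U1WardIdentity` is used.
namespace Summit.Ventures.LatticeQCDFlow.Theory2.Lattice.Flux

open MeasureTheory ProbabilityTheory Real
open scoped ENNReal
open Literature.MathematicalPhysics.QuantumFieldTheory Literature.MathematicalPhysics.QuantumLattice
open Summit.Ventures.LatticeQCDFlow.Exactness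

/-! ## §1 The two-sided insertion kernel on a measurable group -/

section Group

variable {G : Type*} [Group G] [MeasurableSpace G] [MeasurableMul₂ G]

/-- The two-sided insertion law `½(δ_W + δ_{W⁻¹})`. [folklore] -/
def insertionLaw (W : G) : Measure G :=
  (2 : ℝ≥0∞)⁻¹ • (Measure.dirac W + Measure.dirac W⁻¹)

/-- The insertion law is a probability measure. [folklore] -/
instance instIsProbabilityMeasureInsertionLaw (W : G) : IsProbabilityMeasure (insertionLaw W) := by
  refine ⟨?_⟩
  rw [insertionLaw, Measure.smul_apply, Measure.add_apply, measure_univ, measure_univ, smul_eq_mul]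
  rw [show (1 : ℝ≥0∞) + 1 = 2 by norm_num]
  exact ENNReal.inv_mul_cancel two_ne_zero ENNReal.ofNat_ne_top

/-- The insertion law is symmetric under inversion. [folklore] -/
instance instIsInvInvariantInsertionLaw [MeasurableInv G] (W : G) :
    (insertionLaw W).IsInvInvariant := by
  refine ⟨?_⟩
  rw [Measure.inv, insertionLaw, Measure.map_smul, Measure.map_add _ _ measurable_inv,
    Measure.map_dirac' measurable_inv, Measure.map_dirac' measurable_inv, inv_inv, add_comm]

omit [MeasurableMul₂ G] in
/-- Integration against the insertion law. [folklore] -/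
theorem lintegral_insertionLaw (W : G) {g : G → ℝ≥0∞} (hg : Measurable g) :
    ∫⁻ X, g X ∂(insertionLaw W) = 2⁻¹ * (g W + g W⁻¹) := by
  rw [insertionLaw, lintegral_smul_measure, lintegral_add_measure, lintegral_dirac' _ hg,
    lintegral_dirac' _ hg, smul_eq_mul]

/-- **The two-sided flux-insertion Metropolis kernel**: propose `W U` or `W⁻¹ U` with probability `½`
each, accept with `min {1, p(proposal)/p(U)}`. [folklore] -/
def insertionMH (W : G) (p : G → ℝ) : Kernel G G :=
  symMH (mulWalk (insertionLaw W)) p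

/-- The insertion kernel is a Markov kernel. [folklore] -/
instance instIsMarkovKernelInsertionMH (W : G) {p : G → ℝ} [Fact (Measurable p)] :
    IsMarkovKernel (insertionMH W p) := by
  unfold insertionMH; infer_instance

/-- **Exactness.**  For a left-invariant reference measure `μ` (Haar) and every measurable `p > 0`,
`p · μ` is invariant under the insertion kernel. [folklore] -/
theorem insertionMH_invariant [MeasurableInv G] {μ : Measure G} [SFinite μ] [μ.IsMulLeftInvariant] (W : G)
    {p : G → ℝ} (hp : Measurable p) (hp0 : ∀ U, 0 < p U) :
    Kernel.Invariant (insertionMH W p) (μ.withDensity fun U => ENNReal.ofReal (p U)) :=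
  mulWalkMH_invariant hp hp0

variable {p : G → ℝ}

omit [Group G] [MeasurableMul₂ G] in
/-- Measurability of the acceptance in the proposal variable. [folklore] -/
theorem measurable_imhAcceptE_left (hp : Measurable p) (U : G) : Measurable (imhAcceptE p U) :=
  (measurable_imhAcceptE hp).comp measurable_prodMk_left

/-- **Set-wise formula.**  `K(U, B) = ½(1_B(WU) a(U, WU) + 1_B(W⁻¹U) a(U, W⁻¹U)) + (1 − A(U)) 1_B(U)`.
[folklore] -/
theorem insertionMH_apply (W : G) (hp : Measurable p) (U : G) {B : Set G} (hB : MeasurableSet B) :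
    insertionMH W p U B =
      2⁻¹ * (B.indicator (imhAcceptE p U) (W * U) + B.indicator (imhAcceptE p U) (W⁻¹ * U)) +
        (1 - symAcceptMass (mulWalk (insertionLaw W)) p U) * B.indicator 1 U := by
  rw [insertionMH, symMH_apply hp U hB, ← lintegral_indicator hB,
    lintegral_mulWalk _ U ((measurable_imhAcceptE_left hp U).indicator hB),
    lintegral_insertionLaw W (g := fun X => B.indicator (imhAcceptE p U) (X * U))
      (((measurable_imhAcceptE_left hp U).indicator hB).comp (measurable_mul_const U))]

/-- **Floor.**  `K(U, B) ≥ ½(1_B(WU) a(U, WU) + 1_B(W⁻¹U) a(U, W⁻¹U))`. [folklore] -/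
theorem insertionMH_ge (W : G) (hp : Measurable p) (U : G) {B : Set G} (hB : MeasurableSet B) :
    2⁻¹ * (B.indicator (imhAcceptE p U) (W * U) + B.indicator (imhAcceptE p U) (W⁻¹ * U)) ≤
      insertionMH W p U B := by
  rw [insertionMH_apply W hp U hB]
  exact le_self_add

/-- **Support.**  The kernel charges only `{U, WU, W⁻¹U}`. [folklore] -/
theorem insertionMH_eq_zero (W : G) (hp : Measurable p) (U : G) {B : Set G} (hB : MeasurableSet B)
    (h0 : U ∉ B) (h1 : W * U ∉ B) (h2 : W⁻¹ * U ∉ B) : insertionMH W p U B = 0 := by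
  rw [insertionMH_apply W hp U hB, Set.indicator_of_notMem h0, Set.indicator_of_notMem h1,
    Set.indicator_of_notMem h2]
  simp

omit [Group G] [MeasurableSpace G] [MeasurableMul₂ G] in
/-- The acceptance of a proposal `V` under the weight `e^{−βS}` is `min {1, e^{−β(S V − S U)}}`.
[folklore] -/
theorem imhAcceptE_exp (S : G → ℝ) (β : ℝ) (U V : G) :
    imhAcceptE (fun U => Real.exp (-β * S U)) U V =
      ENNReal.ofReal (min 1 (Real.exp (-(β * (S V - S U))))) := by
  rw [imhAcceptE, imhAccept, ← Real.exp_sub]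
  congr 3
  ring

omit [Group G] [MeasurableSpace G] [MeasurableMul₂ G] in
/-- If one of two proposals costs at most `c ≥ 0` in action, the larger acceptance is `≥ e^{−βc}`
(`β ≥ 0`). [folklore] -/
theorem ofReal_exp_le_add_imhAcceptE (S : G → ℝ) {β c : ℝ} (hβ : 0 ≤ β) (hc : 0 ≤ c) {U V V' : G}
    (h : min (S V - S U) (S V' - S U) ≤ c) :
    ENNReal.ofReal (Real.exp (-(β * c))) ≤
      imhAcceptE (fun U => Real.exp (-β * S U)) U V +
        imhAcceptE (fun U => Real.exp (-β * S U)) U V' := by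
  rw [imhAcceptE_exp, imhAcceptE_exp]
  have key : ∀ {x : ℝ}, x ≤ c →
      ENNReal.ofReal (Real.exp (-(β * c))) ≤ ENNReal.ofReal (min 1 (Real.exp (-(β * x)))) := by
    intro x hx
    refine ENNReal.ofReal_le_ofReal (le_min ?_ ?_)
    · rw [Real.exp_le_one_iff, neg_nonpos]
      exact mul_nonneg hβ hc
    · exact Real.exp_le_exp.mpr (neg_le_neg (mul_le_mul_of_nonneg_left hx hβ))
  rcases min_le_iff.mp h with h1 | h1
  · exact (key h1).trans le_self_add
  · exact (key h1).trans le_add_self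

end Group

/-! ## §2 The abelian action identity -/

section Action

variable {d L : ℕ} [NeZero L]

omit [NeZero L] in
/-- `Re(w⁻¹u) + Re(wu) = 2 Re w · Re u` on the unit circle. [folklore] -/
theorem re_inv_mul_add_re_mul (w u : Circle) :
    ((w⁻¹ * u : Circle) : ℂ).re + ((w * u : Circle) : ℂ).re = 2 * (w : ℂ).re * (u : ℂ).re := by
  rw [Circle.coe_mul, Circle.coe_mul, Circle.coe_inv_eq_conj, Complex.mul_re, Complex.mul_re,
    Complex.conj_re, Complex.conj_im]
  ring

/-- The `U(1)` Wilson action as the sum of `1 − Re U_p`. [folklore] -/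
theorem wilsonAction_u1_eq (U : GaugeConfig d L Circle) :
    wilsonAction u1Rep U =
      ∑ q : Plaquette d L, (1 - ((plaquetteHolonomy U q.1 q.2.1.1 q.2.1.2 : Circle) : ℂ).re) := by
  unfold wilsonAction
  refine Finset.sum_congr rfl fun q _ => ?_
  rw [trace_u1Rep_re, Nat.cast_one]

/-- The `U(1)` Wilson action is non-negative. [folklore] -/
theorem wilsonAction_u1_nonneg (U : GaugeConfig d L Circle) : 0 ≤ wilsonAction u1Rep U := by
  rw [wilsonAction_u1_eq]
  refine Finset.sum_nonneg fun q _ => sub_nonneg.mpr ?_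
  exact (Complex.re_le_norm _).trans_eq (Circle.norm_coe _)

/-- **Abelian action identity / inequality.**  For every `W, U`:
`S(WU) + S(W⁻¹U) ≤ 2 S(U) + 2 S(W)` — term by term
`2 Re U_p − Re(W_p U_p) − Re(W_p⁻¹ U_p) = 2(1 − Re W_p) Re U_p ≤ 2(1 − Re W_p)`. [folklore] -/
theorem wilsonAction_mul_add_inv_mul_le (W U : GaugeConfig d L Circle) :
    wilsonAction u1Rep (W * U) + wilsonAction u1Rep (W⁻¹ * U) ≤
      2 * wilsonAction u1Rep U + 2 * wilsonAction u1Rep W := by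
  simp only [wilsonAction_u1_eq, ← Finset.sum_add_distrib, Finset.mul_sum]
  refine Finset.sum_le_sum fun q _ => ?_
  rw [plaquetteHolonomy_mul', plaquetteHolonomy_mul', plaquetteHolonomy_inv]
  set w := plaquetteHolonomy W q.1 q.2.1.1 q.2.1.2
  set u := plaquetteHolonomy U q.1 q.2.1.1 q.2.1.2
  have h := re_inv_mul_add_re_mul w u
  have hw : ((w : Circle) : ℂ).re ≤ 1 := (Complex.re_le_norm _).trans_eq (Circle.norm_coe w)
  have hu : ((u : Circle) : ℂ).re ≤ 1 := (Complex.re_le_norm _).trans_eq (Circle.norm_coe u)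
  nlinarith

/-- Hence ONE of the two insertions costs at most `S(W)`. [folklore] -/
theorem min_wilsonAction_insert_sub_le (W U : GaugeConfig d L Circle) :
    min (wilsonAction u1Rep (W * U) - wilsonAction u1Rep U)
        (wilsonAction u1Rep (W⁻¹ * U) - wilsonAction u1Rep U) ≤ wilsonAction u1Rep W := by
  have h := wilsonAction_mul_add_inv_mul_le W U
  rcases le_total (wilsonAction u1Rep (W * U)) (wilsonAction u1Rep (W⁻¹ * U)) with h1 | h1
  · exact (min_le_left _ _).trans (by linarith)
  · exact (min_le_right _ _).trans (by linarith)

end Action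

/-! ## §3 The acceptance floor for flux tunnelling -/

section Floor

variable {d L : ℕ} [NeZero L]

/-- The Wilson weight function `e^{−βS}` of `U(1)`. [folklore] -/
def u1Weight (β : ℝ) (U : GaugeConfig d L Circle) : ℝ := Real.exp (-β * wilsonAction u1Rep U)

/-- The weight is measurable. [folklore] -/
theorem measurable_u1Weight (β : ℝ) : Measurable (u1Weight (d := d) (L := L) β) :=
  Real.measurable_exp.comp ((measurable_wilsonAction u1Rep continuous_u1Rep).const_mul _)

/-- The weight is positive. [folklore] -/
theorem u1Weight_pos (β : ℝ) (U : GaugeConfig d L Circle) : 0 < u1Weight β U := Real.exp_pos _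

/-- The set of configurations whose charge differs from that of `U` is measurable. [folklore] -/
theorem measurableSet_topCharge_ne (x₀ : Site d L) (μ ν : Fin d) (U : GaugeConfig d L Circle) :
    MeasurableSet {V : GaugeConfig d L Circle | topCharge x₀ μ ν U ≠ topCharge x₀ μ ν V} :=
  (measurableSet_eq_fun measurable_const (measurable_topCharge x₀ μ ν)).compl

/-- **Pointwise floor.**  At a configuration at which BOTH insertions change the flux charge, the
insertion kernel changes it with probability `≥ ½ e^{−β S(W)}` (`β ≥ 0`). [folklore] -/
theorem insertionMH_topCharge_ne_ge {β : ℝ} (hβ : 0 ≤ β) (W : GaugeConfig d L Circle)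
    (x₀ : Site d L) (μ ν : Fin d) {U : GaugeConfig d L Circle}
    (h1 : topCharge x₀ μ ν (W * U) ≠ topCharge x₀ μ ν U)
    (h2 : topCharge x₀ μ ν (W⁻¹ * U) ≠ topCharge x₀ μ ν U) :
    2⁻¹ * ENNReal.ofReal (Real.exp (-(β * wilsonAction u1Rep W))) ≤
      insertionMH W (u1Weight β) U {V | topCharge x₀ μ ν U ≠ topCharge x₀ μ ν V} := by
  refine le_trans ?_ (insertionMH_ge W (measurable_u1Weight β) U (measurableSet_topCharge_ne x₀ μ ν U))
  rw [Set.indicator_of_mem (show W * U ∈ {V | _ ≠ _} from fun h => h1 h.symm),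
    Set.indicator_of_mem (show W⁻¹ * U ∈ {V | _ ≠ _} from fun h => h2 h.symm)]
  exact mul_le_mul_right (ofReal_exp_le_add_imhAcceptE (wilsonAction u1Rep) hβ
    (wilsonAction_u1_nonneg W) (min_wilsonAction_insert_sub_le W U)) _

/-- The good set: both insertions change the charge. [folklore] -/
def bothChange (W : GaugeConfig d L Circle) (x₀ : Site d L) (μ ν : Fin d) :
    Set (GaugeConfig d L Circle) :=
  {U | topCharge x₀ μ ν (W * U) ≠ topCharge x₀ μ ν U ∧ topCharge x₀ μ ν (W⁻¹ * U) ≠ topCharge x₀ μ ν U}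

/-- The good set is measurable. [folklore] -/
theorem measurableSet_bothChange (W : GaugeConfig d L Circle) (x₀ : Site d L) (μ ν : Fin d) :
    MeasurableSet (bothChange W x₀ μ ν) := by
  have hm := measurable_topCharge (L := L) x₀ μ ν
  exact ((measurableSet_eq_fun (hm.comp (measurable_const_mul W)) hm).compl).inter
    ((measurableSet_eq_fun (hm.comp (measurable_const_mul W⁻¹)) hm).compl)

/-- **Integrated floor** (every measure `μ`, no invariance needed):
`(μ ⊗ K){Q ≠ Q'} ≥ ½ e^{−β S(W)} · μ(bothChange)`. [folklore] -/
theorem compProd_insertionMH_topCharge_ne_ge {β : ℝ} (hβ : 0 ≤ β) (W : GaugeConfig d L Circle)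
    (x₀ : Site d L) (μ' ν' : Fin d) (μ : Measure (GaugeConfig d L Circle)) [SFinite μ] :
    2⁻¹ * ENNReal.ofReal (Real.exp (-(β * wilsonAction u1Rep W))) * μ (bothChange W x₀ μ' ν') ≤
      (μ ⊗ₘ insertionMH W (u1Weight β))
        {q | topCharge x₀ μ' ν' q.1 ≠ topCharge x₀ μ' ν' q.2} := by
  haveI : Fact (Measurable (u1Weight (d := d) (L := L) β)) := ⟨measurable_u1Weight β⟩
  have hm := measurable_topCharge (L := L) x₀ μ' ν'
  have hE : MeasurableSet {q : GaugeConfig d L Circle × GaugeConfig d L Circle |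
      topCharge x₀ μ' ν' q.1 ≠ topCharge x₀ μ' ν' q.2} :=
    (measurableSet_eq_fun (hm.comp measurable_fst) (hm.comp measurable_snd)).compl
  rw [Measure.compProd_apply hE, ← lintegral_indicator_const (measurableSet_bothChange W x₀ μ' ν')]
  refine lintegral_mono fun U => ?_
  by_cases hU : U ∈ bothChange W x₀ μ' ν'
  · rw [Set.indicator_of_mem hU]
    exact insertionMH_topCharge_ne_ge hβ W x₀ μ' ν' hU.1 hU.2
  · rw [Set.indicator_of_notMem hU]; exact bot_le

end Floor

/-! ## §5 The action of the slice twist (used by item 99) -/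

section SliceTwistAction

variable {L : ℕ} [NeZero L]

omit [NeZero L] in
/-- In two dimensions the plaquettes are the sites. [folklore] -/
def plaquetteEquivSite : Plaquette 2 L ≃ Site 2 L where
  toFun q := q.1
  invFun x := (x, ⟨((0 : Fin 2), (1 : Fin 2)), by decide⟩)
  left_inv q := by
    obtain ⟨h0, h1⟩ := plaquette_dirs_eq q
    exact Prod.ext rfl (Subtype.ext (Prod.ext h0.symm h1.symm))
  right_inv _ := rfl

/-- `Re e^{2πi/L}⁻¹ = cos(2π/L)`. [folklore] -/
theorem re_toCircle_one_inv :
    (((ZMod.toCircle (1 : ZMod L))⁻¹ : Circle) : ℂ).re = Real.cos (2 * π / L) := by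
  rw [Circle.coe_inv_eq_conj, Complex.conj_re, toCircle_one_eq_exp, Circle.coe_exp,
    Complex.exp_ofReal_mul_I_re]

/-- A line sum: `Σ_{x : (ℤ/L)²} [x₀ = 0] c = L c`. [folklore] -/
theorem sum_site_ite_eq (c : ℝ) :
    ∑ x : Site 2 L, (if x 0 = 0 then c else 0) = L * c := by
  rw [Fintype.sum_equiv (piFinTwoEquiv fun _ => ZMod L) (fun x : Site 2 L => if x 0 = 0 then c else 0)
    (fun ab : ZMod L × ZMod L => if ab.1 = 0 then c else 0) (fun x => rfl), Fintype.sum_prod_type,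
    Finset.sum_eq_single_of_mem (0 : ZMod L) (Finset.mem_univ _) (fun a _ ha => by simp [ha])]
  show (∑ _y : ZMod L, if (0 : ZMod L) = 0 then c else 0) = L * c
  rw [if_pos rfl, Finset.sum_const, Finset.card_univ, ZMod.card, nsmul_eq_mul]

/-- **`S(sliceTwist L) = L(1 − cos(2π/L))`.** [folklore] -/
theorem wilsonAction_sliceTwist :
    wilsonAction u1Rep (sliceTwist L) = L * (1 - Real.cos (2 * π / L)) := by
  rw [wilsonAction_u1_eq]
  have h1 : ∀ q : Plaquette 2 L,
      (1 - ((plaquetteHolonomy (sliceTwist L) q.1 q.2.1.1 q.2.1.2 : Circle) : ℂ).re) =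
        (fun x : Site 2 L => if x 0 = 0 then 1 - Real.cos (2 * π / L) else 0)
          (plaquetteEquivSite q) := by
    intro q
    obtain ⟨h0, h1⟩ := plaquette_dirs_eq q
    rw [h0, h1, plaquetteHolonomy_sliceTwist]
    show _ = if q.1 0 = 0 then _ else _
    split_ifs with hx
    · rw [re_toCircle_one_inv]
    · rw [Circle.coe_one, Complex.one_re, sub_self]
  simp_rw [h1]
  rw [Fintype.sum_equiv plaquetteEquivSite
    (fun q : Plaquette 2 L => if plaquetteEquivSite q 0 = 0 then 1 - Real.cos (2 * π / L) else 0)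
    (fun x : Site 2 L => if x 0 = 0 then 1 - Real.cos (2 * π / L) else 0) (fun q => rfl),
    sum_site_ite_eq]

end SliceTwistAction

end Summit.Ventures.LatticeQCDFlow.Theory2.Lattice.Flux

end
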